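import Literature.AlgebraicGeometry.Modules.TildeLocallyFree
import HarnessLib

/-!
# The inverse image `f^*(M~) ≅ (S ⊗_R M)~` on global sections: `m ↦ 1 ⊗ m` (GW I Prop. 7.24 (2))

Görtz–Wedhorn, *Algebraic Geometry I* (2nd ed. 2020), Prop. 7.24 (2) and its proof: for
`f = Spec φ : Spec S → Spec R` and an `R`-module `M`, the isomorphism `f^*(M̃) ≅ (S ⊗_R M)~` is
the one whose adjunct `M → Γ(Spec R, f_* (S ⊗_R M)~) = S ⊗_R M` (restriction of scalars) is
`m ↦ 1 ⊗ m` ("by adjunction and Yoneda"). `Literature.AlgebraicGeometry.Modules.TildePullback`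
constructs the isomorphism `pullbackTildeIso φ M` abstractly, by uniqueness of left adjoints
(Mathlib `Adjunction.leftAdjointUniq`); this file extracts the printed description of it on global
sections, which is what computations with restrictions of sections to thickenings need:

* `tildePullbackAdjunction_unit_comp_pullbackTildeIso` — the defining property: the unit of the
  composite adjunction `(M ↦ f^*M~) ⊣ (𝓕 ↦ Γ(f_*𝓕))` followed by `Γ(f_* pullbackTildeIso)` is the unit
  of `(M ↦ (S ⊗ M)~) ⊣ (𝓕 ↦ φ_*Γ(𝓕))` (Mathlib `Adjunction.unit_leftAdjointUniq_hom_app`);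
* `tilde_unit_comp_pullback_unit_comp_pullbackTildeIso` — the same with the composite units
  expanded (`M → Γ(M~) → Γ(f_*f^*M~) → Γ(f_*(S ⊗ M)~)` equals `M → S ⊗ M → Γ((S ⊗ M)~)`);
* `pushforwardCompModuleSpecΓFunctorIso_inv_app_apply` — the comparison
  `Γ(Spec S, 𝓕)|_R = Γ(Spec R, f_*𝓕)` is the identity on elements (`rfl`);
* **`pullbackTildeIso_unit_toOpen_top`** — ON ELEMENTS: the global section `m` of `M~`, pulled back
  to `f^*M~` (unit of `f^* ⊣ f_*`) and moved along `pullbackTildeIso`, is the global section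
  `1 ⊗ m` of `(S ⊗_{R,φ} M)~`;
* **`pullbackSpecTildeIso_unit_toOpen_top`** — the same for the `Algebra` form
  `pullbackSpecTildeIso : (Spec (algebraMap R S))^* M~ ≅ (S ⊗_R M)~` of
  `Literature.AlgebraicGeometry.Modules.TildeLocallyFree`, with Mathlib's honest `S ⊗_R M`.
* `extendScalarsIsoBaseChange_hom_naturality`, `pullbackSpecTildeIso_hom_naturality` — the
  `Algebra`-form isomorphisms are natural in `M` ("functorial in `M`", loc. cit.).

Everything is proved; no definitions, no named facts.

## References

* U. Görtz, T. Wedhorn, *Algebraic Geometry I: Schemes*, 2nd ed., Springer Spektrum (2020),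
  Prop. 7.24 (2) and its proof. [GortzWedhorn2020]
-/

noncomputable section

-- `TopCat.Presheaf`/`Scheme.Modules` are not reducible (as in Mathlib's `AlgebraicGeometry/Modules/Tilde.lean`).
set_option backward.isDefEq.respectTransparency false

open CategoryTheory AlgebraicGeometry Opposite TopologicalSpace TensorProduct
open scoped ChangeOfRings

universe u

namespace Literature.AlgebraicGeometry.Modules

section RingHom

variable {R S : CommRingCat.{u}} (φ : R ⟶ S) (M : ModuleCat.{u} R)

/-- **The defining property of `pullbackTildeIso` (uniqueness of left adjoints)**: the unit of
`(M ↦ f^*M~) ⊣ (𝓕 ↦ Γ(Spec R, f_*𝓕))` followed by `Γ(f_* pullbackTildeIso φ M)` is the unit of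
`(M ↦ (S ⊗ M)~) ⊣ (𝓕 ↦ φ_*Γ(Spec S, 𝓕))` (transported along `Γ(f_*𝓕) = φ_*Γ(𝓕)`).
[cite: GortzWedhorn2020, Prop 7.24 (2) (proof)] -/
theorem tildePullbackAdjunction_unit_comp_pullbackTildeIso :
    (tildePullbackAdjunction φ).unit.app M ≫
      (Scheme.Modules.pushforward (Spec.map φ) ⋙ moduleSpecΓFunctor (R := R)).map
        (pullbackTildeIso φ M).hom =
    (extendScalarsTildeAdjunction φ).unit.app M ≫
      (pushforwardCompModuleSpecΓFunctorIso φ).inv.app _ := by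
  have h := Adjunction.unit_leftAdjointUniq_hom_app (tildePullbackAdjunction φ)
    ((extendScalarsTildeAdjunction φ).ofNatIsoRight (pushforwardCompModuleSpecΓFunctorIso φ).symm) M
  conv at h =>
    rhs
    rw [← Adjunction.homEquiv_id, Adjunction.homEquiv_ofNatIsoRight_apply, Adjunction.homEquiv_id,
      Iso.symm_hom]
  exact h

/-- The same with the composite units expanded: `M → Γ(M~) → Γ(f_*f^*M~) → Γ(f_*(S ⊗ M)~)` equals
`M → S ⊗_{R,φ} M → Γ((S ⊗ M)~)` followed by the comparison `φ_*Γ = Γ f_*`. [folklore] -/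
theorem tilde_unit_comp_pullback_unit_comp_pullbackTildeIso :
    (tilde.adjunction (R := R)).unit.app M ≫
      (moduleSpecΓFunctor (R := R)).map
        ((Scheme.Modules.pullbackPushforwardAdjunction (Spec.map φ)).unit.app (tilde M)) ≫
      (moduleSpecΓFunctor (R := R)).map ((Scheme.Modules.pushforward (Spec.map φ)).map
        (pullbackTildeIso φ M).hom) =
    (ModuleCat.extendRestrictScalarsAdj.{u, u, u} φ.hom).unit.app M ≫
      (ModuleCat.restrictScalars.{u, u, u} φ.hom).map
        ((tilde.adjunction (R := S)).unit.app ((ModuleCat.extendScalars.{u, u, u} φ.hom).obj M)) ≫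
      (pushforwardCompModuleSpecΓFunctorIso φ).inv.app _ := by
  have h := tildePullbackAdjunction_unit_comp_pullbackTildeIso φ M
  rw [tildePullbackAdjunction, extendScalarsTildeAdjunction, Adjunction.comp_unit_app,
    Adjunction.comp_unit_app] at h
  simp only [Functor.comp_map, Category.assoc] at h
  exact h

/-- The comparison `φ_*Γ(Spec S, 𝓕) ≅ Γ(Spec R, f_*𝓕)` (`pushforwardCompModuleSpecΓFunctorIso`) is
the identity on elements. [folklore] -/
theorem pushforwardCompModuleSpecΓFunctorIso_inv_app_apply (X : (Spec S).Modules)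
    (x : (moduleSpecΓFunctor (R := S)).obj X) :
    ((pushforwardCompModuleSpecΓFunctorIso φ).inv.app X) x = x :=
  rfl

/-- **Görtz–Wedhorn I, Prop. 7.24 (2) on global sections**: the global section `m` of `M~`, pulled
back to `f^*M~` (unit of `f^* ⊣ f_*`) and moved along `pullbackTildeIso φ M : f^*M~ ≅ (S ⊗_{R,φ} M)~`,
is the global section `1 ⊗ m` of `(S ⊗_{R,φ} M)~` (`f = Spec φ`).
[cite: GortzWedhorn2020, Prop 7.24 (2) (proof)] -/
theorem pullbackTildeIso_unit_toOpen_top (m : M) :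
    ((moduleSpecΓFunctor (R := R)).map ((Scheme.Modules.pushforward (Spec.map φ)).map
        (pullbackTildeIso φ M).hom))
      (((moduleSpecΓFunctor (R := R)).map
        ((Scheme.Modules.pullbackPushforwardAdjunction (Spec.map φ)).unit.app (tilde M)))
          (tilde.toOpen M ⊤ m)) =
    tilde.toOpen ((ModuleCat.extendScalars.{u, u, u} φ.hom).obj M) ⊤ ((1 : S) ⊗ₜ[R, φ.hom] m) :=
  congrArg (fun ψ => (ModuleCat.Hom.hom ψ) m)
    (tilde_unit_comp_pullback_unit_comp_pullbackTildeIso φ M)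

end RingHom

section Algebra

variable {R : CommRingCat.{u}} {S : Type u} [CommRing S] [Algebra R S] (M : ModuleCat.{u} R)

/-- **Görtz–Wedhorn I, Prop. 7.24 (2) on global sections, `Algebra` form**: the global section `m`
of `M~`, pulled back along `Spec (algebraMap R S)` and moved along
`pullbackSpecTildeIso M : (Spec S → Spec R)^* M~ ≅ (S ⊗_R M)~`, is the global section `1 ⊗ m` of
`(S ⊗_R M)~`. [cite: GortzWedhorn2020, Prop 7.24 (2) (proof)] -/
theorem pullbackSpecTildeIso_unit_toOpen_top (m : M) :
    ((moduleSpecΓFunctor (R := R)).map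
        ((Scheme.Modules.pushforward (Spec.map (CommRingCat.ofHom (algebraMap R S)))).map
          (pullbackSpecTildeIso M).hom))
      (((moduleSpecΓFunctor (R := R)).map
        ((Scheme.Modules.pullbackPushforwardAdjunction
          (Spec.map (CommRingCat.ofHom (algebraMap R S)))).unit.app (tilde M)))
            (tilde.toOpen M ⊤ m)) =
    tilde.toOpen (ModuleCat.of (CommRingCat.of S) (S ⊗[R] M)) ⊤ ((1 : S) ⊗ₜ[R] m) := by
  have h0 := pullbackTildeIso_unit_toOpen_top (CommRingCat.ofHom (algebraMap R S)) M m
  have hmap := congrArg (fun ψ => (ModuleCat.Hom.hom ψ)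
      ((1 : S) ⊗ₜ[R, (CommRingCat.ofHom (algebraMap R S)).hom] m))
    (tilde.toOpen_map_app (R := CommRingCat.of S)
      (extendScalarsIsoBaseChange (R := R) (S := S) M).hom ⊤)
  have e1 : (extendScalarsIsoBaseChange (R := R) (S := S) M).hom
      ((1 : S) ⊗ₜ[R, (CommRingCat.ofHom (algebraMap R S)).hom] m) = (1 : S) ⊗ₜ[R] m :=
    extendScalarsToBaseChange_one_tmul M m
  simp only [ModuleCat.hom_comp, LinearMap.comp_apply] at hmap
  rw [e1] at hmap
  exact (congrArg (fun y => ((modulesSpecToSheaf.map (tilde.map (R := CommRingCat.of S)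
    (extendScalarsIsoBaseChange (R := R) (S := S) M).hom)).1.app (op ⊤)) y) h0).trans hmap

end Algebra

section Naturality

variable {R : CommRingCat.{u}} {S : Type u} [CommRing S] [Algebra R S]

/-- **`(extendScalars (algebraMap R S)).obj M ≅ S ⊗_R M` is natural in `M`**: it intertwines
`(extendScalars).map g` and `g.baseChange S`. [folklore] -/
theorem extendScalarsIsoBaseChange_hom_naturality {M N : ModuleCat.{u} R} (g : M ⟶ N) :
    (ModuleCat.extendScalars.{u, u, u} (algebraMap R S)).map g ≫
        (extendScalarsIsoBaseChange (R := R) (S := S) N).hom =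
      (extendScalarsIsoBaseChange (R := R) (S := S) M).hom ≫
        ModuleCat.ofHom (Y := ModuleCat.of S (S ⊗[R] N)) (g.hom.baseChange S) := by
  apply ModuleCat.ExtendScalars.hom_ext
  intro m
  change (extendScalarsIsoBaseChange (R := R) (S := S) N).hom
      ((ModuleCat.extendScalars.{u, u, u} (algebraMap R S)).map g ((1 : S) ⊗ₜ[R, algebraMap R S] m)) =
    (g.hom.baseChange S) ((extendScalarsIsoBaseChange (R := R) (S := S) M).hom
      ((1 : S) ⊗ₜ[R, algebraMap R S] m))
  rw [ModuleCat.ExtendScalars.map_tmul]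
  exact (extendScalarsToBaseChange_one_tmul N (g.hom m)).trans
    ((LinearMap.baseChange_tmul (A := S) g.hom 1 m).symm.trans
      (congrArg (g.hom.baseChange S) (extendScalarsToBaseChange_one_tmul M m).symm))

/-- **`pullbackSpecTildeIso : (Spec S → Spec R)^* M~ ≅ (S ⊗_R M)~` is natural in `M`**: it
intertwines `(Spec S → Spec R)^*(g~)` and `(S ⊗ g)~` (GW I Prop. 7.24 (2), "functorial in `M`").
[cite: GortzWedhorn2020, Prop 7.24 (2)] -/
@[reassoc]
theorem pullbackSpecTildeIso_hom_naturality {M N : ModuleCat.{u} R} (g : M ⟶ N) :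
    (Scheme.Modules.pullback (Spec.map (CommRingCat.ofHom (algebraMap R S)))).map (tilde.map g) ≫
        (pullbackSpecTildeIso N).hom =
      (pullbackSpecTildeIso M).hom ≫ tilde.map (R := CommRingCat.of S)
        (ModuleCat.ofHom (Y := ModuleCat.of S (S ⊗[R] N)) (g.hom.baseChange S)) := by
  rw [pullbackSpecTildeIso, pullbackSpecTildeIso, Iso.trans_hom, Iso.trans_hom, Functor.mapIso_hom,
    Functor.mapIso_hom, ← Category.assoc, pullbackTildeIso_hom_naturality, Category.assoc,
    Category.assoc, tilde.functor_map, tilde.functor_map]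
  congr 1
  change (tilde.functor (CommRingCat.of S)).map _ ≫ (tilde.functor (CommRingCat.of S)).map _ =
    (tilde.functor (CommRingCat.of S)).map _ ≫ (tilde.functor (CommRingCat.of S)).map _
  rw [← Functor.map_comp, ← Functor.map_comp]
  exact congrArg _ (extendScalarsIsoBaseChange_hom_naturality g)

end Naturality

end Literature.AlgebraicGeometry.Modules
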